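import Summits.BirchSwinnertonDyer.Rank1Residual.GaloisImage.KuriharaLowerBoundThreeOfKolyvaginProductCyclic
import Summits.BirchSwinnertonDyer.Rank1Residual.GaloisImage.KuriharaTowerPackaging
import Summits.BirchSwinnertonDyer.Rank1Residual.GaloisImage.KatoKuriharaPortThree
import Summits.BirchSwinnertonDyer.Rank1Residual.GaloisImage.TorsionReductionOfLe
import Summits.BirchSwinnertonDyer.Rank1Residual.X4.OptimalPeriod
import Literature.NumberTheory.EllipticCurves.AgasheRibetStein2006.ManinConstantOptimalCurves
import Literature.NumberTheory.EllipticCurves.NonEisensteinPrimeOfSurjective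
import Summits.BirchSwinnertonDyer.Rank1Residual.X4.KuriharaParityNewform
import Literature.NumberTheory.EllipticCurves.MordellWeilRankZeroProofs
import Literature.NumberTheory.EllipticCurves.ComplexMultiplicationBurungaleFlachProofs
import Literature.NumberTheory.EllipticCurves.AnalyticRankOrderProofs
import HarnessLib

/-!
# The RECORD-READY OUTPUT SHAPE of sub-route (a′) at `p = 3` on class A1: Kurihara's LOWER half from a
# pair certificate, the `3`-adic tower, [S24] (1)(2), the Poitou–Tate families, `hEP`, ONE port
# (cell `b2b-bsdres`, team n1011, ROUTE-1 R1-45 (d)+(e); row T-R1-45 FILE E1; seat p18)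

HONEST FRAMING (cell `b2b-bsdres`, run/shared/lean/b2b/bsd-rank1-residual/, verbatim in every
file): the goal of the cell is to DELETE the COMBINATION-SHAPED residual classes of the
Birch–Swinnerton-Dyer formula for ALL analytic-rank `≤ 1` elliptic curves over `ℚ` — "full BSD
formula for every rank `≤ 1` curve in class `C`" assembled STRICTLY from published theorems — so
that the rank-`≤ 1` remainder becomes exactly the CONSTRUCTION-SHAPED classes, which are TYPED
(missing-input `Prop`s), NOT attempted. This is not "finishing BSD". Team n1011 (N10/N11, the
additive block `X4 ∧ p = 3`): research route; PER-PAIR record shape, NOT a class theorem; TOOL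
theorems only (no definition, no named fact); nothing booked; no mark / label moved.  CONDITIONAL
on: the named facts `hS24`/`hS24₂` ([S24] Thm. 4.4 (1)(2)), the Poitou–Tate families, Tate's
`hEP`, ONE typed PORT hypothesis `KatoKuriharaPortThreeAt W 0 v₃` (FLAG `K22-Thm3.13-PORT@3`, the
DICT3 debt line), and — for the UPPER half of `BSD(E,3)` — the five named facts of the X4 chain of
record (`hKatoS hDel hmodD hL20 hKatoχ`) with `hGZK`, `hmod`, `h26`, exactly as
`Additive/X4ThreeResCertKernel.lean`.  The certificate lines (`hn`, `hcyc`, `hnN`, `hψ`, `hcert`,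
`hv`) are per-record EVIDENCE decided in the kernel on numerals.

## What and why

Planner r1 (ROUTE-1 §27.6 R1-45, §29.5): turn the END THEOREM of (a′)
(`Assembly.padicValRat_le_of_kolyvaginProduct_of_card_torsion_le`, p278772; ~45 binders) into ONE
record-ready corollary on class A1 (`t = 0`: `E(ℚ₃)[3] = 0`; `j = 1`; shallow depth `k = 0`) whose
binders are {row deciders, the named facts, PT, `hEP`, ONE `hPort`, the pair certificate} and
NOTHING else.  This file does it:

* `Assembly.exists_LOmega_padicValRat_le_of_towerSurj` — the OUTPUT SHAPE
  `∃ q, L(E,1)/Ω(W) = q ∧ ord₃ q ≤ ord₃ #Ш(E)(3)` from the tower, [S24] (1)(2), PT, `hEP`, the port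
  and a certificate `δ̃_n(ψ) ≢ 0 (mod 3)` at `n ∈ 𝒩₁` with the cyclicity flag, `∀ ℓ ∣ n, ℓ ∤ N`, and
  `δ̃_d(ψ) = 0` at the proper sub-levels; every ∀k′ family of the END theorem is DISCHARGED by this
  seat's `TowerPackage.exists_towerFamily` / `towerAdmissible` (FILE D), the reduction maps by
  n1011-p11's `exists_torsionReduction_three`, the dictionary by the port
  (`KatoKuriharaPortThreeAt.dictionary₂`, FILE C), `hper`/`hcP` by the optimal datum
  (`periodTransfer_of_optimal`, `not_dvd_maninConstant_of_level_le`), finiteness of `E(ℚ)` and `Ш`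
  by GZK at rank `0`, `L(E,1) ≠ 0` by modularity;
* `Assembly.exists_LOmega_padicValRat_le_of_towerSurj_of_pair` — the same for a PAIR `n`
  (`ν(n) = 2`) with the sub-level vanishing DISCHARGED BY PARITY (additive-p4's
  `kuriharaNumber_eq_zero_of_fricke_of_sign`: in analytic rank `0` every single-prime Kurihara
  number vanishes) from the Fricke sign `w_N f = −f` and the level identity `N_E = N`;
* the `BSD(E,3)` corollaries through additive-p4's LOWER-half sockets (potentially good
  unit-Tamagawa / (M) / Tamagawa-defect-one rows) are the sequel file
  `KuriharaRecordBSDpThree.lean` (≤ 400-line rule).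

S-B1 sentinel (r1 §28.3 / §29.5): beyond the §29.2 per-prime inputs the assembly surfaced NO extra
hypothesis; `hv` (sub-levels) is arithmetic in the general form and parity-discharged on pairs at
the price of `hN : N_E = N` + the Fricke sign (both decidable per record / engine-known).

References: C.-H. Kim, AJM 148 (2026) Thm. 1.9 (6), Thm. 3.13 [Kim2022StructureSelmer]; R. Sakamoto,
JTNB 36 (2024) Thm. 4.4 [Sakamoto2024]; K. Kato, Astérisque 295 (2004) Thm. 14.5 (3)
[Kato2004Asterisque]; A. Agashe, K. Ribet, W. Stein (2006) Thm. 2.6 [AgasheRibetStein2006];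
R. L. Miller, LMS JCM 14 (2011) Def. 1.1 [Miller2011LMS]; B. Mazur, J. Tate, J. Teitelbaum, Invent.
84 (1986) §I.17 [MazurTateTeitelbaum1986Invent].
-/

noncomputable section

open scoped Classical NumberField ContRepresentation
open Function Field NumberField IsDedekindDomain IsDedekindDomain.HeightOneSpectrum WeierstrassCurve
  CongruenceSubgroup
  Literature.NumberTheory.EllipticCurves Literature.NumberTheory.EllipticCurves.ModularForms
  Literature.NumberTheory.EllipticCurves.Rank1Residual
  Literature.NumberTheory.EllipticCurves.AgasheRibetStein2006
  Literature.NumberTheory.GaloisRepresentations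
  Literature.NumberTheory.GaloisRepresentations.DiscreteGaloisModule Literature.NumberTheory.GaloisCohomology
  Rat.HeightOneSpectrum
  Summit.BirchSwinnertonDyer.Rank1Residual.Additive Summit.BirchSwinnertonDyer.Rank1Residual.X4

namespace Summit.BirchSwinnertonDyer.Rank1Residual.GaloisImage.Assembly

/-- **The OUTPUT SHAPE of (a′) at `p = 3` on class A1, record-ready.**  `W/ℚ` globally minimal,
ADDITIVE at `3` with `3 ∤ c₃`, the `3`-adic tower `ρ̄_{E,3^n}` onto for every `n`, `E(ℚ₃)[3] = 0`,
analytic rank `0`, an OPTIMAL parametrisation datum `D` at a level `N ≤ 130000`; the named facts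
`hS24`/`hS24₂`, the Poitou–Tate family `inv` at `3` (three properties) and `inv′ k′` at every
`3^{k′+1}` (four properties), Tate's `hEP`, GZK, modularity, `h26`; ONE port
`KatoKuriharaPortThreeAt W 0 v₃`; and a CERTIFICATE: `n ∈ 𝒩₁(E,3)` with the cyclicity flag
`#(E₀ mod ℓ)(𝔽_ℓ)[3] ≤ 3` at its primes, `ℓ ∤ N` for `ℓ ∣ n`, surjective discrete logarithms `ψ`,
`δ̃_n(ψ) ≢ 0 (mod 3)` and `δ̃_d(ψ) = 0` for `1 < d < n`, `d ∣ n`.  THEN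
`∃ q, L(E,1)/Ω(W) = q ∧ ord₃ q ≤ ord₃ #Ш(E)(3)` — Kurihara's LOWER half.  Every ∀k′ family of the END
theorem p278772 is discharged inside (FILE D); nothing else is assumed.
[cite: Kim2022StructureSelmer, Thm. 1.9 (6) and Thm. 3.13] [cite: Sakamoto2024, Thm. 4.4 (p. 926)]
[cite: AgasheRibetStein2006, Thm. 2.6 (p. 619)] -/
theorem exists_LOmega_padicValRat_le_of_towerSurj
    (hS24 : Sakamoto2024.kolyvaginSystems_freeRankOne_zmod_three_pow)
    (hS24₂ : Sakamoto2024.kolyvaginSystems_idealOfBasis_eq_fittingIdeal_zmod_three_pow)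
    (hGZK : rank_eq_analyticRank_of_analyticRank_le_one) (hmod : hasEntireLFunction_rat)
    (h26 : cremona_abs_maninConstant_eq_one_of_level_le)
    (W : WeierstrassCurve ℚ) [W.IsElliptic] [W.IsGloballyMinimal]
    -- the row
    (hadd : haveI : Fact (Nat.Prime 3) := ⟨Nat.prime_three⟩; Addv W 3)
    (hc3 : ¬ 3 ∣ (W.baseChange ℚ_[3]).localTamagawaNumber ℤ_[3])
    (htower : ∀ m : ℕ, W.HasSurjectiveModNGaloisRep (3 ^ m : ℕ))
    (ht0 : Nat.card {Q : (W.baseChange ℚ_[3]).toAffine.Point // (3 : ℕ) • Q = 0} = 1)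
    (hr : W.analyticRank = 0)
    {N : ℕ} [NeZero N] (hN : N ≤ 130000) (D : ModularParametrizationData W N)
    (hopt : ∀ z ∈ D.L.lattice, ∃ w ∈ periodLattice D.f, z = D.c * w)
    -- the Poitou–Tate families and Tate's local Euler characteristic
    (inv : LocalInvariants ℚ 3) (hperf : inv.IsPerfect) (hsum : inv.SumLocalTermEqZero)
    (hcompl : inv.SelmerComplement)
    (inv' : ∀ k' : ℕ, LocalInvariants ℚ (3 ^ (k' + 1))) (hperf' : ∀ k', (inv' k').IsPerfect)
    (hsum' : ∀ k', (inv' k').SumLocalTermEqZero) (hcompl' : ∀ k', (inv' k').SelmerComplement)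
    (hinj' : ∀ k', ∀ v : HeightOneSpectrum (𝓞 ℚ), Injective (inv' k' (Sum.inr v)))
    (hEP : ∀ v : HeightOneSpectrum (𝓞 ℚ), localEulerPoincareCharacteristic (v.adicCompletion ℚ))
    -- ONE port
    (v₃ : HeightOneSpectrum (𝓞 ℚ)) (hv₃ : ((3 : ℕ) : 𝓞 ℚ) ∈ v₃.asIdeal)
    (hPort : KatoKuriharaPortThreeAt W 0 v₃)
    -- the certificate
    (n : ℕ) [NeZero n] (hn : Kato.IsKolyvaginProduct W 3 1 n)
    (hcyc : ∀ (ℓ : ℕ) [Fact ℓ.Prime], ℓ ∣ n →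
      Nat.card {P : ((integralModelInt W).map (Int.castRingHom (ZMod ℓ))).toAffine.Point //
        3 • P = 0} ≤ 3)
    (hnN : ∀ ℓ ∈ n.primeFactors, ¬ ℓ ∣ N)
    (ψ : (ℓ : ℕ) → (ZMod ℓ)ˣ →* Multiplicative (ZMod (3 ^ 1)))
    (hψ : ∀ ℓ ∈ n.primeFactors, Function.Surjective (ψ ℓ))
    (hcert : kuriharaNumber D.f (3 ^ 1) n ψ ≠ 0)
    (hv : ∀ d : ℕ, d ∣ n → 1 < d → d < n → ∀ [NeZero d], kuriharaNumber D.f (3 ^ 1) d ψ = 0) :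
    ∃ q : ℚ, W.entireLFunction 1 / (W.realPeriodRat : ℂ) = (q : ℂ) ∧
      padicValRat 3 q ≤ (padicValNat 3 (Nat.card (AddCommGroup.primaryComponent W.sha 3)) : ℤ) := by
  haveI : Fact (Nat.Prime 3) := ⟨Nat.prime_three⟩
  -- the row: `L(E,1) ≠ 0`, `E(ℚ)` and `Ш` finite, surj(3)
  have hL : W.entireLFunction 1 ≠ 0 := by
    rw [← W.leadingLCoeff_eq_of_analyticRank_eq_zero hr]
    exact W.leadingLCoeff_ne_zero_holds (hmod W)
  have hGZ := hGZK W (by rw [hr]; exact zero_le_one)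
  haveI : Finite W.sha := hGZ.2
  haveI : Finite W.toAffine.Point := W.mordellWeilRank_eq_zero_iff_holds.mp (by rw [hGZ.1, hr])
  have hsurj : W.HasSurjectiveModNGaloisRep ((3 : ℕ) : ℤ) := by simpa using htower 1
  have hsurj0 : W.HasSurjectiveModNGaloisRep (((3 : ℕ) : ℤ) ^ 0 * ((3 : ℕ) : ℤ)) := by
    simpa using htower 1
  -- the optimal datum: `3 ∤ c_D`, the period transfer
  have hcD : ¬ (3 : ℤ) ∣ D.maninConstant := not_dvd_maninConstant_of_level_le h26 W D hopt hN Nat.prime_three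
  have hper : ∃ u : ℚ, ‖(u : ℚ_[3])‖ = 1 ∧ W.realPeriodRat = u * plusPeriod D.f :=
    periodTransfer_of_optimal 3 D hopt hcD
  have hcP : ¬ ((3 : ℕ) : ℤ) ∣ D.maninConstant := by exact_mod_cast hcD
  -- the admissible set `T = {v ∣ 3} ∪ {bad}` and `S = S(T)`
  obtain ⟨T, h3T, hbadT, hTmem, hT, h𝓕T, h𝓚T, hfinT, hfinS⟩ := TowerPackage.towerAdmissible W
  have hS : ∀ w : InfinitePlace ℚ, (Sum.inl w : Place ℚ) ∈ finSupport T := inl_mem_finSupport T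
  have h3S : ∀ v : HeightOneSpectrum (𝓞 ℚ), ((3 : ℕ) : 𝓞 ℚ) ∈ v.asIdeal →
      (Sum.inr v : Place ℚ) ∈ finSupport T := fun v hv => (inr_mem_finSupport_iff T v).mpr (h3T v hv)
  have hbadS : ∀ v : HeightOneSpectrum (𝓞 ℚ), ¬ W.HasGoodReductionAt v →
      (Sum.inr v : Place ℚ) ∈ finSupport T := fun v hv => (inr_mem_finSupport_iff T v).mpr (hbadT v hv)
  have hSgood : ∀ v ∉ {v : HeightOneSpectrum (𝓞 ℚ) | (Sum.inr v : Place ℚ) ∈ finSupport T},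
      W.HasGoodReductionAt v ∧ ((3 : ℕ) : 𝓞 ℚ) ∉ v.asIdeal := fun v hv =>
    ⟨by_contra fun h => hv (hbadS v h), fun h => hv (h3S v h)⟩
  have hSmem : ∀ v ∈ {v : HeightOneSpectrum (𝓞 ℚ) | (Sum.inr v : Place ℚ) ∈ finSupport T},
      ¬ W.HasGoodReductionAt v ∨ ((3 : ℕ) : 𝓞 ℚ) ∈ v.asIdeal := fun v hv =>
    hTmem v ((inr_mem_finSupport_iff T v).mp hv)
  -- the tower families (FILE D) and the reduction maps (p11)
  obtain ⟨τ, η, D', g', hτμ, hτq, hP', hDT', hD', hg', hgo', hgen', hR22', hUT', hPS', hPP'⟩ :=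
    TowerPackage.exists_towerFamily W hS24 hS24₂ htower inv hperf hsum hcompl hEP (finSupport T) hS
      h3S hbadS
  choose red hred using fun k' => exists_torsionReduction_three W 0 k'
  -- the dictionary from the port
  have hD0 : (D' 0).IsCanonicalTauDatumThreeAt W (0 + 0) 0 :=
    isCanonicalTauDatumThreeAt_of_primes_eq hSgood (hτμ 0) (hτq 0) (hP' 0) (hDT' 0) (hD' 0)
  have hDk : ∀ k', (D' k').IsCanonicalTauDatumThreeAt W (k' + 0) k' := fun k' =>
    isCanonicalTauDatumThreeAt_of_primes_eq hSgood (hτμ k') (hτq k') (hP' k') (hDT' k') (hD' k')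
  have hdict := hPort.dictionary₂ hD0 hDk red
  -- the END theorem at `(t, k, j) = (0, 0, 1)` with `D := D′ 0`
  obtain ⟨q, hq, hle⟩ := padicValRat_le_of_kolyvaginProduct_of_card_torsion_le W 0 0 (D' 0) v₃ hv₃
    hadd hc3 hsurj (by rw [ht0, pow_zero]) hL D hcP hper (hDT' 0) (g' 0) (hg' 0) (hgen' 0) D' hDT'
    hPP' red hred hdict g' hg' hgo' hgen' inv' hperf' hsum' hcompl' hinj' hEP (fun _ => T)
    (fun _ => h3T v₃ hv₃) hT h𝓕T h𝓚T hfinT hfinS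
    (fun q hq => fun h => hPS' 0 q hq ((inr_mem_finSupport_iff T q).mpr h))
    (fun k' q hq => fun h => hPS' k' q hq ((inr_mem_finSupport_iff T q).mpr h))
    (hUT' 0) hUT'
    (fun d hd => hR22' 0 (inv' 0) (hperf' 0) (hsum' 0) (hcompl' 0) d hd)
    (fun k' d hd => hR22' k' (inv' k') (hperf' k') (hsum' k') (hcompl' k') d hd)
    hSmem (hτμ 0) (hτq 0) (hP' 0) hsurj0 n hn hcyc hnN (j := 1) le_rfl ψ hψ hcert hv
  exact ⟨q, hq, by simpa using hle⟩


/-- **The OUTPUT SHAPE on a PAIR certificate, sub-levels discharged BY PARITY.**  Same as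
`exists_LOmega_padicValRat_le_of_towerSurj` for `n` with exactly two prime factors (`ν(n) = 2`),
the vanishing of `δ̃_d(ψ)` at the proper sub-levels (the two primes) being DISCHARGED from the level
identity `N_E = N` and the rank-`0` Fricke sign `w_N f = −f` by additive-p4's parity theorem
(`kuriharaNumber_eq_zero_of_fricke_of_sign`: in even analytic rank every single-prime Kurihara
number mod `3` vanishes, via the Hecke relation of the plus symbol at primes `q ∤ N`, MTT §I.4).
[cite: Kim2022StructureSelmer, Thm. 1.9 (6)] [cite: MazurTateTeitelbaum1986Invent, §I.17 and §I.4 (4.2)] -/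
theorem exists_LOmega_padicValRat_le_of_towerSurj_of_pair
    (hS24 : Sakamoto2024.kolyvaginSystems_freeRankOne_zmod_three_pow)
    (hS24₂ : Sakamoto2024.kolyvaginSystems_idealOfBasis_eq_fittingIdeal_zmod_three_pow)
    (hGZK : rank_eq_analyticRank_of_analyticRank_le_one) (hmod : hasEntireLFunction_rat)
    (h26 : cremona_abs_maninConstant_eq_one_of_level_le)
    (W : WeierstrassCurve ℚ) [W.IsElliptic] [W.IsGloballyMinimal]
    (hadd : haveI : Fact (Nat.Prime 3) := ⟨Nat.prime_three⟩; Addv W 3)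
    (hc3 : ¬ 3 ∣ (W.baseChange ℚ_[3]).localTamagawaNumber ℤ_[3])
    (htower : ∀ m : ℕ, W.HasSurjectiveModNGaloisRep (3 ^ m : ℕ))
    (ht0 : Nat.card {Q : (W.baseChange ℚ_[3]).toAffine.Point // (3 : ℕ) • Q = 0} = 1)
    (hr : W.analyticRank = 0)
    {N : ℕ} [NeZero N] (hN : N ≤ 130000) (D : ModularParametrizationData W N)
    (hopt : ∀ z ∈ D.L.lattice, ∃ w ∈ periodLattice D.f, z = D.c * w)
    (hNE : W.conductorNorm ℤ = N) (hε : atkinLehnerInvolution N 2 N D.f = -D.f)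
    (inv : LocalInvariants ℚ 3) (hperf : inv.IsPerfect) (hsum : inv.SumLocalTermEqZero)
    (hcompl : inv.SelmerComplement)
    (inv' : ∀ k' : ℕ, LocalInvariants ℚ (3 ^ (k' + 1))) (hperf' : ∀ k', (inv' k').IsPerfect)
    (hsum' : ∀ k', (inv' k').SumLocalTermEqZero) (hcompl' : ∀ k', (inv' k').SelmerComplement)
    (hinj' : ∀ k', ∀ v : HeightOneSpectrum (𝓞 ℚ), Injective (inv' k' (Sum.inr v)))
    (hEP : ∀ v : HeightOneSpectrum (𝓞 ℚ), localEulerPoincareCharacteristic (v.adicCompletion ℚ))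
    (v₃ : HeightOneSpectrum (𝓞 ℚ)) (hv₃ : ((3 : ℕ) : 𝓞 ℚ) ∈ v₃.asIdeal)
    (hPort : KatoKuriharaPortThreeAt W 0 v₃)
    (n : ℕ) [NeZero n] (hn : Kato.IsKolyvaginProduct W 3 1 n) (hn2 : n.primeFactors.card = 2)
    (hcyc : ∀ (ℓ : ℕ) [Fact ℓ.Prime], ℓ ∣ n →
      Nat.card {P : ((integralModelInt W).map (Int.castRingHom (ZMod ℓ))).toAffine.Point //
        3 • P = 0} ≤ 3)
    (ψ : (ℓ : ℕ) → (ZMod ℓ)ˣ →* Multiplicative (ZMod (3 ^ 1)))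
    (hψ : ∀ ℓ ∈ n.primeFactors, Function.Surjective (ψ ℓ))
    (hcert : kuriharaNumber D.f (3 ^ 1) n ψ ≠ 0) :
    ∃ q : ℚ, W.entireLFunction 1 / (W.realPeriodRat : ℂ) = (q : ℂ) ∧
      padicValRat 3 q ≤ (padicValNat 3 (Nat.card (AddCommGroup.primaryComponent W.sha 3)) : ℤ) := by
  haveI : Fact (Nat.Prime 3) := ⟨Nat.prime_three⟩
  haveI : NeZero ((3 : ℕ) : ℚ) := ⟨by norm_num⟩
  have hn0 : n ≠ 0 := hn.ne_zero
  -- the level is prime to every Kolyvagin prime (`N = N_E`)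
  have hnN : ∀ ℓ ∈ n.primeFactors, ¬ ℓ ∣ N := fun ℓ hℓ hℓN =>
    (hn.2 ℓ hℓ).not_dvd_conductorNorm (hNE ▸ hℓN)
  -- parity: every single-prime Kurihara number mod `3` vanishes in analytic rank `0`
  have hsurj3 : W.HasSurjectiveModNGaloisRep ((3 : ℕ) : ℤ) := by simpa using htower 1
  have hirr : W.HasIrreducibleModPGaloisRep 3 :=
    hasIrreducibleModPGaloisRep_of_hasSurjectiveModNGaloisRep W 3 hsurj3
  have hε' : atkinLehnerInvolution N 2 N D.f = (-((1 : ℤ) : ℂ)) • D.f := by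
    rw [hε, Int.cast_one, neg_one_smul]
  have hH : ∀ q : ℕ, Kato.IsKolyvaginPrime W 3 1 q →
      LevelLowering.HeckeRel (fun r : ℚ ↦ ((ratPlusSymbol D.f r : ℚ) : ZMod 3)) q
        (W.frobeniusTrace q : ZMod 3) := fun q hq =>
    LevelLowering.heckeRel_ratCast_ratPlusSymbol_of_irreducible (by norm_num) D.isNewformOf hirr
      hq.prime (by rw [← hNE]; exact hq.not_dvd_conductorNorm)
  refine exists_LOmega_padicValRat_le_of_towerSurj hS24 hS24₂ hGZK hmod h26 W hadd hc3 htower ht0 hr hN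
    D hopt inv hperf hsum hcompl inv' hperf' hsum' hcompl' hinj' hEP v₃ hv₃ hPort n hn hcyc hnN ψ hψ
    hcert fun d hdn h1d hdlt _ => ?_
  -- a proper divisor `1 < d < n` of the pair is one of its primes
  have hdsq : Squarefree d := hn.squarefree.squarefree_of_dvd hdn
  have hsub : d.primeFactors ⊆ n.primeFactors := Nat.primeFactors_mono hdn hn0
  have hne : d.primeFactors ≠ n.primeFactors := fun h => (ne_of_lt hdlt) (by
    rw [← Nat.prod_primeFactors_of_squarefree hdsq, ← Nat.prod_primeFactors_of_squarefree
      hn.squarefree, h])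
  have hlt : d.primeFactors.card < 2 := hn2 ▸ Finset.card_lt_card (hsub.ssubset_of_ne hne)
  have hpos : 0 < d.primeFactors.card :=
    Finset.card_pos.mpr (Nat.nonempty_primeFactors.mpr h1d)
  have hcard : d.primeFactors.card = 1 := by omega
  have hnd : Kato.IsKolyvaginProduct W 3 1 d := ⟨hdsq, fun ℓ hℓ => hn.2 ℓ (hsub hℓ)⟩
  have hNd : N.Coprime d := Nat.coprime_of_dvd fun ℓ hℓp hℓN hℓd =>
    hnN ℓ (Nat.mem_primeFactors.mpr ⟨hℓp, hℓd.trans hdn, hn0⟩) hℓN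
  exact LevelLowering.kuriharaNumber_eq_zero_of_fricke_of_sign W 3 D.f (by norm_num) (Or.inl rfl) hε'
    hH hnd hNd (by rw [hcard]; norm_num) ψ

end Summit.BirchSwinnertonDyer.Rank1Residual.GaloisImage.Assembly

end
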